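import Summits.Ventures.GridStability.Bench.NE39SPPrintedData
import HarnessLib

/-!
# GridStability/Bench/NE39SPPrintedRoa — rung «G2.b-SP NE39», route (b), file 2 of 2: the synchronous
# equilibrium of the PRINTED injections EXISTS (kernel), and its certified region of attraction

Cell `gridfusion` (LADDER-GRIDFUSION), `plan/PARTITION.md` A25 route (b) (lead 2026-08-27T01:16:41Z
(2) / 01:37:36Z); seat gridfusion-lyap-1 (g3); namespace `Summit.Ventures.GridStability.Bench.NE39SP`.
INPUTS: file 1 `Bench/NE39SPPrintedData.lean` (printed injections `PfixQ` with the declared slack,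
instance `paramsB D`, and the three hypotheses of lit-1's existence theorem discharged for the data:
`marginB` (i), `coerciveB` (ii, tree Poincaré — `Lyapunov/TreePoincare.lean`), `residualB` (iii, one
kernel evaluation over `ℚ`), plus `level_lt_levelBound_routeB`); lit-1's
`ClassicalModel.exists_equilibrium_of_residual_reference` (p481514); this seat's
`Lyapunov.StructurePreserving.sublevel_subset_regionOfAttraction` (p475989) through model-2's
re-export `Params.energySublevel_subset_regionOfAttraction` (p478610).

THREE COLUMNS. CERTIFIED (kernel): `exists_equilibriumB` — an angle vector `θ⋆` pinned to `δ₀` at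
G1, with `|θ⋆ᵢ − δ₀ᵢ| < 2·10⁻⁶` at every node, solving ALL 49 lossless power-flow equations
`Σⱼ bᵢⱼ sin(θ⋆ᵢ − θ⋆ⱼ) = Pᵢ` for the PRINTED injections (+ the one declared slack datum) EXACTLY,
every coupled branch inside `2·arctan τ′ ≈ 23.23°`; `printed_roa` — for every `D > 0`, `θ⋆` is a
synchronous equilibrium of `paramsB D` and `S_{29/10}(θ⋆) ⊆ ROA((θ⋆, 0))` a priori (existence of
the global solution + every global solution). MODELLED (model-2's tokens): «MV-3 + lossless +
MV-P(9e-5 @ slack) + D(∀) + 60-Hz base (ω_s := 377) + V-frozen(LF) + |E|′(h12)». VALIDATED: nothing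
here. No sentence of this file says that the New England system or any grid is stable. Theorems
only; no named fact; standard axioms.
-/

noncomputable section

open Set Filter Topology Real Finset
open Summit.Ventures.GridStability.Models
open Summit.Ventures.GridStability.Models.StructurePreserving
open Summit.Ventures.GridStability.Models.NE39SP
open Literature.MathematicalPhysics.PowerSystems

namespace Summit.Ventures.GridStability.Bench.NE39SP

/-! ## The equilibrium of the printed injections EXISTS (lit-1 p481514, hypotheses (i)–(iii) above) -/

/-- `Σ P = 0` over `ℝ`. -/
theorem sum_Pfix_real : ∑ i, ((PfixQ i : ℚ) : ℝ) = 0 := by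
  have h : (∑ i, (PfixQ i : ℝ)) = ((∑ i, PfixQ i : ℚ) : ℝ) := by push_cast; rfl
  rw [h, sum_PfixQ]; simp

/-- `0 ≤ γ < π/2` for `γ = 2·arctan τ′`. -/
theorem gammaB_bounds :
    0 ≤ 2 * Real.arctan (tauB : ℝ) ∧ 2 * Real.arctan (tauB : ℝ) < π / 2 :=
  ⟨Lyapunov.StructurePreserving.two_mul_arctan_nonneg tauB_bounds.1,
    Lyapunov.StructurePreserving.two_mul_arctan_lt_pi_div_two tauB_bounds.2⟩

/-- **EXISTENCE of the synchronous angle vector for the PRINTED injections** (with the declared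
slack): there is `θ⋆ : Fin 49 → ℝ`, pinned to `δ₀` at the reference machine G1, within
`|θ⋆ᵢ − δ₀ᵢ| < 2·10⁻⁶` of the half-angle point at EVERY node, solving ALL 49 lossless power-flow
equations `Σⱼ bᵢⱼ sin(θ⋆ᵢ − θ⋆ⱼ) = Pᵢ` EXACTLY, with every coupled branch inside
`|θ⋆ᵢ − θ⋆ⱼ| < 2·arctan τ′ ≈ 23.23°`. Kernel route: lit-1's
`ClassicalModel.exists_equilibrium_of_residual_reference` [cite: DvijothamLowChertkov2015, §3.3
Corollary 1; BoydVandenberghe2004, §9.1.2 eq. (9.11)] with (i) `marginB`, (ii) `coerciveB`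
(tree Poincaré), (iii) `residualB`. CERTIFIED column (about MODEL M′'s power-flow map). -/
theorem exists_equilibriumB :
    ∃ θ : Fin 49 → ℝ, θ 39 = NE39SP.δ₀ 39 ∧ (∀ i, |θ i - NE39SP.δ₀ i| < (RB : ℝ)) ∧
      (∀ i, ∑ j, NE39SP.b i j * Real.sin (θ i - θ j) = (PfixQ i : ℝ)) ∧
      (∀ i j, i ≠ j → 0 < NE39SP.b i j → |θ i - θ j| < 2 * Real.arctan (tauB : ℝ)) := by
  have hγ : 2 * Real.arctan (tauB : ℝ) ≤ π := by linarith [gammaB_bounds.2, Real.pi_pos]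
  have hc₀ : (c0B : ℝ) ≤ Real.cos (2 * Real.arctan (tauB : ℝ)) := c0B_eq_cos.le
  have hR : (0 : ℝ) < (RB : ℝ) := by exact_mod_cast (show (0 : ℚ) < RB by unfold RB; norm_num)
  have hμ : (0 : ℝ) < (muB : ℝ) := by
    exact_mod_cast (show (0 : ℚ) < muB by unfold muB c0B tauB tauLF betaLF; norm_num)
  obtain ⟨θ, h39, hball, -, heq, hcoh⟩ :=
    ClassicalModel.exists_equilibrium_of_residual_reference NE39SP.b (fun i => (PfixQ i : ℝ))
      NE39SP.b_symm (fun i j _ => NE39SP.b_nonneg i j) sum_Pfix_real 39 NE39SP.δ₀ hγ hc₀ hR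
      hμ (fun i j _ hb => marginB i j hb) (fun v hv => coerciveB v hv) residualB
  exact ⟨θ, h39, hball, heq, hcoh⟩

/-- A solution of the power-flow equations for the printed injections is a synchronous equilibrium
of `paramsB D` for EVERY `D` (`ω₀ = 0`, `P̄ = P⁰ = P_fixed`). -/
theorem isSyncEquilibriumB (D : Fin 49 → ℝ) {θ : Fin 49 → ℝ}
    (heq : ∀ i, ∑ j, NE39SP.b i j * Real.sin (θ i - θ j) = (PfixQ i : ℝ)) :
    (paramsB D).IsSyncEquilibrium θ := by
  intro i
  rw [Pbar_paramsB]
  show ∑ j, (paramsB D).b i j * Real.sin (θ i - θ j) = _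
  rw [paramsB_b]
  exact heq i

/-! ## THE SENTENCE of route (b) -/

/-- **Rung «G2.b-SP NE39», route (b) — certified region of attraction for the PRINTED injections.**
There is an angle vector `θ⋆` (the synchronous equilibrium of the printed lossless load flow with
the ONE declared slack datum, `|θ⋆ᵢ − δ₀ᵢ| < 2·10⁻⁶` at every node, coupled branches inside
`2·arctan τ′ < π/2`) such that for EVERY damping / load-frequency vector `D > 0`: `θ⋆` is a
synchronous equilibrium of MODEL M′ = `paramsB D` (MV-3 structure-preserving, column LF), and from
every phase point of `S = {V(θ⋆; δ, ω) ≤ 29/10} ∩ {|δᵢ − δⱼ| < π/2 on coupled pairs} ∩ {L(δ, ω) =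
L(θ⋆, 0), ω_bus = 0}` a global solution of the structure-preserving field exists and EVERY global
solution stays in `S` and tends to `(θ⋆, 0)` (this seat's p475989 via model-2's re-export, at the
certified level `level_lt_levelBound_routeB`). MODELLED tokens «MV-3 + lossless + MV-P(9e-5 @
slack) + D(∀) + 60-Hz base (ω_s := 377) + V-frozen(LF) + |E|′(h12)»; no sentence here says a grid is
stable. [cite: Padiyar2013, App. D; §3.2 eq (3.2)] -/
theorem printed_roa :
    ∃ θs : Fin 49 → ℝ,
      θs 39 = NE39SP.δ₀ 39 ∧ (∀ i, |θs i - NE39SP.δ₀ i| < (RB : ℝ)) ∧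
      (∀ i, ∑ j, NE39SP.b i j * Real.sin (θs i - θs j) = (PfixQ i : ℝ)) ∧
      (∀ i j, i ≠ j → 0 < NE39SP.b i j → |θs i - θs j| < 2 * Real.arctan (tauB : ℝ)) ∧
      ∀ D : Fin 49 → ℝ, (∀ i, 0 < D i) →
        (paramsB D).IsSyncEquilibrium θs ∧
        ∀ y : (Fin 49 → ℝ) × (Fin 49 → ℝ),
          y ∈ (paramsB D).window ∩ (paramsB D).constraintSet θs ∧
              (paramsB D).energy θs y.1 y.2 ≤ 29 / 10 →
          (∃ X : ℝ → (Fin 49 → ℝ) × (Fin 49 → ℝ), X 0 = y ∧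
              ∀ T : ℝ, ∀ s ∈ Icc 0 T,
                HasDerivWithinAt X ((paramsB D).shifted.phaseField (X s)) (Icc 0 T) s) ∧
          ∀ X : ℝ → (Fin 49 → ℝ) × (Fin 49 → ℝ), X 0 = y →
            (∀ T : ℝ, ∀ s ∈ Icc 0 T,
              HasDerivWithinAt X ((paramsB D).shifted.phaseField (X s)) (Icc 0 T) s) →
            (∀ s, 0 ≤ s → X s ∈ (paramsB D).window ∩ (paramsB D).constraintSet θs ∧
              (paramsB D).energy θs (X s).1 (X s).2 ≤ 29 / 10) ∧
            Tendsto X atTop (𝓝 (θs, 0)) := by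
  obtain ⟨θs, h39, hball, heq, hcoh⟩ := exists_equilibriumB
  refine ⟨θs, h39, hball, heq, hcoh, fun D hD => ⟨isSyncEquilibriumB D heq, fun y hy => ?_⟩⟩
  have h0 : ∀ i j, (paramsB D).b i j ≠ 0 → |θs i - θs j| ≤ 2 * Real.arctan (tauB : ℝ) := by
    intro i j hb
    rw [paramsB_b] at hb
    by_cases hij : i = j
    · subst hij; simp [gammaB_bounds.1]
    · exact (hcoh i j hij (lt_of_le_of_ne (NE39SP.b_nonneg i j) (Ne.symm hb))).le
  have hc : (29 / 10 : ℝ) < (1 - Real.sin (2 * Real.arctan (tauB : ℝ)))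
      / (π / 2 - 2 * Real.arctan (tauB : ℝ)) * (betaLF : ℝ)
      * (π / 2 - 2 * Real.arctan (tauB : ℝ)) ^ 2 / 4 := by
    have h := level_lt_levelBound_routeB
    unfold Lyapunov.StructurePreserving.levelBound at h
    exact h
  exact (paramsB D).energySublevel_subset_regionOfAttraction (wellFormedB hD) (by decide)
    (preconnectedB D) (fun i j => by rw [paramsB_b]; exact NE39SP.b_nonneg i j) beta_pos
    (edge_lowerB D) gammaB_bounds.1 gammaB_bounds.2 h0 (isSyncEquilibriumB D heq) hc hy

end Summit.Ventures.GridStability.Bench.NE39SP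

end
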